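import Summits.Langlands.Langlands.Theorems.IrreducibilityBySelfDualityAdjointLiftFromRegularTwist
import Summits.Langlands.Langlands.Theorems.IrreducibilityBySelfDualityRegularTwistCM
import HarnessLib

/-!
# Crux `RegularAdjointLiftCM` (route `IrreducibilityBySelfDuality`, item stmt-Langlands-13617) — the crux body
# modulo the three archimedean named facts of its sibling `RegularTwistCM` (Theses-free, cycle-free)

Line lead `prover-line-stmt-Langlands-13617-0`, line `nu-cubed-central-character` (2026-08-16).  The line is
assembled in the tree: its three registered stubs are landed theorems
(`RegularAdjointLiftCM.stub_centralCharacterInfinityType`, `….stub_cubeRootAlgebraic`,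
`….stub_hermitianSymmetry` = Clozel purity on multisets, `Literature/…/ClozelPurityProofs.lean`), and its
composition `RegularTwistCM → RegularAdjointLiftCM` is the landed glue item `AdjointLiftFromRegularTwist`
(stmt-Langlands-14725, `AdjointLiftFromRegularTwist_proof`, frame form).  The sibling crux `RegularTwistCM`
(stmt-Langlands-14069) is landed MODULO its three archimedean named facts
(`RegularTwistCM.regularTwistCM_of_facts`).  Composing the two gives the honest status of THIS crux:

* `regularAdjointLiftCM_of_facts` — **the crux body (verbatim, route file rev 16) modulo the three named
  facts** `GelbartJacquet_adjoint_lift_archimedean` (Gelbart–Jacquet 1978, Thm. (9.3) with its archimedean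
  clause), `strong_multiplicity_one_gl_sphericalLevel 3 K` for all `K` (Jacquet–Shalika 1981 II, Thm. 4.4)
  and `exists_hasInfinityType` for cuspidal `GL₂` data (Clozel 1990, §3.3, the integral pairing at a
  complex place).  CONDITIONAL result: the item closes the day these three facts are discharged (then
  `regularAdjointLiftCM_of_facts h₁ h₂ h₃` is the closing term; by the standing Disproof §11 the crux and its
  sibling are equivalent modulo the inputs, so no cheaper route exists inside the line).

CYCLE HAZARD (kill criterion (e) of the route): the conclusion is the BODY of
`Summit.Langlands.Langlands.Theses.IrreducibilityBySelfDuality.RegularAdjointLiftCM` inlined verbatim, so that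
its type `δ`-unfolds to the route decl while this module imports only Theses-free modules (the two landed
frame-form files above) — the gate's `_holds` link can import it without a cycle.

No definition, no new mathematics: a two-line composition.  Axioms: `propext`, `Classical.choice`,
`Quot.sound`.
-/

set_option linter.dupNamespace false -- project-wide option; `Summit.Langlands.Langlands` is the mandated namespace

noncomputable section

open scoped Classical
open Filter

namespace Summit.Langlands.Langlands.Theorems

/-- **The crux `RegularAdjointLiftCM` (stmt-Langlands-13617) modulo the three archimedean named facts of
`RegularTwistCM`** (CONDITIONAL result; structural statement: the body of the route decl verbatim).  For `K`
CM and `π` regular algebraic cuspidal on `GL₃(𝔸_K)`, essentially self-dual at Satake level, GIVEN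
Ramakrishnan's Satake-level descent (the inlined antecedent): a REGULAR ALGEBRAIC non-dihedral cuspidal `σ`
on `GL₂(𝔸_K)` and a regular algebraic `GL(1)` datum `ν` with `t_π = ν · Ad(t_σ)` a.e. — granted
`GelbartJacquet_adjoint_lift_archimedean`, `strong_multiplicity_one_gl_sphericalLevel 3 K` (all `K`) and
`exists_hasInfinityType` for cuspidal `GL₂` data.  Proof: `AdjointLiftFromRegularTwist_proof` (the line
`nu-cubed-central-character`, landed as item stmt-Langlands-14725) after `RegularTwistCM.regularTwistCM_of_facts`.
[cite: GelbartJacquet1978, Thm. (9.3), Prop. (3.2)] [cite: JacquetShalikaAJM1981II, Thm. 4.4]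
[cite: Clozel1990, §3.3 and Lemme 4.9] [cite: Ramakrishnan2014, Thm. A] -/
theorem regularAdjointLiftCM_of_facts :
    Literature.NumberTheory.Automorphic.GelbartJacquet_adjoint_lift_archimedean →
    (∀ (K : Type) [Field K] [NumberField K],
      Literature.NumberTheory.Automorphic.strong_multiplicity_one_gl_sphericalLevel 3 K) →
    (∀ (K : Type) [Field K] [NumberField K]
      (hcpt₂ : Literature.NumberTheory.Automorphic.isCompact_glFiniteIntegralLevel 2 K)
      (σ₀ : Literature.NumberTheory.Automorphic.CuspidalAutomorphicRepData 2 K hcpt₂),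
      σ₀.1.exists_hasInfinityType) →
    -- conclusion `RegularAdjointLiftCM` (route decl body, verbatim, rev 16)
    ((∀ (F : Type) [Field F] [NumberField F] (hF1 : _) (hF2 : _) (hF3 : _) (P : Literature.NumberTheory.Automorphic.CuspidalAutomorphicRepData 3 F hF3) (η : Literature.NumberTheory.Automorphic.CuspidalAutomorphicRepData 1 F hF1), (∀ᶠ v in cofinite, ∀ α : Multiset ℂ, P.1.HasSatakeParamAt v α → ∃ e : ℂ, η.1.HasSatakeParamAt v {e} ∧ α.map (fun a => a⁻¹) = α.map (fun a => e * a)) → ∃ (π : Literature.NumberTheory.Automorphic.CuspidalAutomorphicRepData 2 F hF2) (ν : Literature.NumberTheory.Automorphic.CuspidalAutomorphicRepData 1 F hF1), (∀ (L : Type) [Field L] [NumberField L] [Algebra F L], Module.finrank F L = 2 → ¬ (∀ᶠ v in cofinite, ∀ β : Multiset ℂ, π.1.HasSatakeParamAt v β → β.map (fun b => (if ∃ w : IsDedekindDomain.HeightOneSpectrum (NumberField.RingOfIntegers L), w.asIdeal.under (NumberField.RingOfIntegers F) = v.asIdeal ∧ w.asIdeal.inertiaDeg (NumberField.RingOfIntegers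 F) = 1 then (1 : ℂ) else -1) * b) = β)) ∧ ∀ᶠ v in cofinite, ∀ β : Multiset ℂ, π.1.HasSatakeParamAt v β → ∃ d e : ℂ, ν.1.HasSatakeParamAt v {d} ∧ η.1.HasSatakeParamAt v {e} ∧ d ^ 2 * e = 1 ∧ P.1.HasSatakeParamAt v ((((β ×ˢ β).map (fun p : ℂ × ℂ => p.1 * p.2⁻¹)).erase 1).map (fun c => d * c))) → ∀ (K : Type) [Field K] [NumberField K], NumberField.IsCMField K → ∀ (h1 : _) (hcpt₂ : _) (hcpt : _) (π : Literature.NumberTheory.Automorphic.CuspidalAutomorphicRepData 3 K hcpt), π.1.IsRegularAlgebraic → (∃ η : Literature.NumberTheory.Automorphic.CuspidalAutomorphicRepData 1 K h1, ∀ᶠ v in cofinite, ∀ α : Multiset ℂ, π.1.HasSatakeParamAt v α → ∃ e : ℂ, η.1.HasSatakeParamAt v {e} ∧ α.map (fun a => a⁻¹) = α.map (fun a => e * a)) → ∃ (σ : Literature.NumberTheory.Automorphic.CuspidalAutomorphicRepData 2 K hcpt₂) (ν : Literature.NumberTheory.Automorphic.CuspidalAutomorphicRepData 1 K h1), σ.1.IsRegularAlgebraic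 ∧ ν.1.IsRegularAlgebraic ∧ (∀ (L : Type) [Field L] [NumberField L] [Algebra K L], Module.finrank K L = 2 → ¬ (∀ᶠ v in cofinite, ∀ β : Multiset ℂ, σ.1.HasSatakeParamAt v β → β.map (fun b => (if ∃ w : IsDedekindDomain.HeightOneSpectrum (NumberField.RingOfIntegers L), w.asIdeal.under (NumberField.RingOfIntegers K) = v.asIdeal ∧ w.asIdeal.inertiaDeg (NumberField.RingOfIntegers K) = 1 then (1 : ℂ) else -1) * b) = β)) ∧ ∀ᶠ v in cofinite, ∀ α β : Multiset ℂ, π.1.HasSatakeParamAt v α → σ.1.HasSatakeParamAt v β → ∃ d : ℂ, ν.1.HasSatakeParamAt v {d} ∧ α = (((β ×ˢ β).map (fun p : ℂ × ℂ => p.1 * p.2⁻¹)).erase 1).map (fun c => d * c)) :=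
  fun hGJ hsmo hIT =>
    AdjointLiftFromRegularTwist_proof (RegularTwistCM.regularTwistCM_of_facts hGJ hsmo hIT)

end Summit.Langlands.Langlands.Theorems

end
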